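import Mathlib
import Summits.ValiantsHypothesis.ValiantsHypothesis.Theorems.SymPencilEquivariantSdcNotQPPermEmbeddingOfYoungBounds
import Summits.ValiantsHypothesis.ValiantsHypothesis.Theorems.SymPencilEquivariantSdcNotQPYoungDegreeBoundPrelim
import Summits.ValiantsHypothesis.ValiantsHypothesis.Theorems.SymPencilSymmetrizePermPairsSmallIndexPairs
import Literature.Computability.Cryptography.BLPRSMachineRejParams
import HarnessLib

/-!
# ValiantsHypothesis / SymPencil — crux `SymmetrizePermPairs` (stmt-ValiantsHypothesis-17793),
# stub `stub_induce`, ASSEMBLY [A1], preliminaries: arithmetic of the budget and the two-degree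
# alternating core `Alt(Ω∖X₁) × Alt(Ω∖X₂)`

Bookkeeping for `permEmbeddingD_sub_of_bounds` (`…PermEmbeddingDSub.lean`): monotonicity of the
quasi-polynomial budget (`qp_mono`), `log₂ max ≤ log₂ + log₂` (`2^m ≤ (m+1)!` is the tree's
`Literature.Computability.Cryptography.BLPRS2013.two_pow_le_factorial_succ`), the main-regime
exponent inequality (`budget_main`), perfectness of `𝔄_a × 𝔄_b` for `a, b ≥ 5`
(`commutator_alternating_prod_eq_top₂`, Mathlib `commutator_alternatingGroup_eq_top`), and the index
bound `[𝔖_n : Alt(Ω ∖ X)] ≤ 2 n^{|X|}` (`index_altFixing_le`, from `SmallIndex.two_mul_card_altFixing`).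

Honest framing: helper layer for an OPEN stub of an OPEN crux; `VP ≠ VNP` is NOT proved and nothing
here is progress on it.  No new definitions, no named facts
(`--supports stmt-ValiantsHypothesis-17793 --as helper`).
-/

noncomputable section

-- `Summit.ValiantsHypothesis.ValiantsHypothesis.…` is the tree's mandated single-conjunct layout
-- (Sub = Summit), so the duplicated namespace component is intended.
set_option linter.dupNamespace false

namespace Summit.ValiantsHypothesis.ValiantsHypothesis.Theorems.SymPencilEquivariantSdcNotQP

open Matrix Equiv Equiv.Perm

namespace PermEmbeddingSub

/-! ### Arithmetic -/

/-- Monotonicity of the quasi-polynomial budget `2^{(x+d)^d}` in `x` and `d ≥ 1`. [folklore] -/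
theorem qp_mono {x y d d' : ℕ} (hxy : x ≤ y) (hd : d ≤ d') (h1 : 1 ≤ d) :
    2 ^ ((x + d) ^ d) ≤ 2 ^ ((y + d') ^ d') := by
  refine Nat.pow_le_pow_right (by norm_num) ?_
  calc (x + d) ^ d ≤ (y + d') ^ d := Nat.pow_le_pow_left (by omega) d
    _ ≤ (y + d') ^ d' := Nat.pow_le_pow_right (by omega) hd

/-- `log₂ (max M R) ≤ log₂ M + log₂ R`. [folklore] -/
theorem log_max_le (M R : ℕ) : Nat.log 2 (max M R) ≤ Nat.log 2 M + Nat.log 2 R := by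
  rcases max_choice M R with h | h <;> rw [h] <;> omega

/-- Main-regime exponent:
`(L+A+c)^c + (L+1) + (2 + (A+1)(2(B+1))) ≤ (L+A+B+(c+4))^{c+4}`. [folklore] -/
theorem budget_main (c L A B : ℕ) :
    (L + A + c) ^ c + (L + 1) + (2 + (A + 1) * (2 * (B + 1))) ≤ (L + A + B + (c + 4)) ^ (c + 4) := by
  set x := L + A + B + (c + 4) with hx
  have hx4 : 4 ≤ x := by omega
  have h1 : (L + A + c) ^ c ≤ x ^ c := Nat.pow_le_pow_left (by omega) c
  have h2 : (A + 1) * (2 * (B + 1)) ≤ 2 * x ^ 2 := by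
    have hA : A + 1 ≤ x := by omega
    have hB : B + 1 ≤ x := by omega
    calc (A + 1) * (2 * (B + 1)) = 2 * ((A + 1) * (B + 1)) := by ring
      _ ≤ 2 * (x * x) := Nat.mul_le_mul_left _ (Nat.mul_le_mul hA hB)
      _ = 2 * x ^ 2 := by ring
  have h3 : L + 3 ≤ x ^ 2 := by nlinarith
  have hxc : 1 ≤ x ^ c := Nat.one_le_pow _ _ (by omega)
  have h4 : 1 + 3 * x ^ 2 ≤ x ^ 3 := by nlinarith
  calc (L + A + c) ^ c + (L + 1) + (2 + (A + 1) * (2 * (B + 1)))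
      ≤ x ^ c + 3 * x ^ 2 := by omega
    _ ≤ x ^ c * (1 + 3 * x ^ 2) := by nlinarith
    _ ≤ x ^ c * x ^ 3 := Nat.mul_le_mul_left _ h4
    _ = x ^ (c + 3) := by rw [← pow_add]
    _ ≤ x ^ (c + 4) := Nat.pow_le_pow_right (by omega) (by omega)

/-! ### Group theory -/

/-- `𝔄_a × 𝔄_b` is perfect for `a, b ≥ 5`. [folklore] -/
theorem commutator_alternating_prod_eq_top₂ (a b : ℕ) (ha : 5 ≤ a) (hb : 5 ≤ b) :
    commutator (↥(alternatingGroup (Fin a)) × ↥(alternatingGroup (Fin b))) = ⊤ := by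
  have hA : commutator ↥(alternatingGroup (Fin a)) = ⊤ :=
    commutator_alternatingGroup_eq_top (by rw [Nat.card_eq_fintype_card, Fintype.card_fin]; exact ha)
  have hB : commutator ↥(alternatingGroup (Fin b)) = ⊤ :=
    commutator_alternatingGroup_eq_top (by rw [Nat.card_eq_fintype_card, Fintype.card_fin]; exact hb)
  rw [commutator] at hA hB ⊢
  rw [← Subgroup.top_prod_top, Subgroup.commutator_prod_prod, hA, hB, Subgroup.top_prod_top]

/-- The complement of `X ⊆ Fin n` has `n − |X|` elements. [folklore] -/
theorem fintype_card_notMem {n : ℕ} (X : Finset (Fin n)) :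
    Fintype.card {x // x ∉ X} = n - X.card := by
  rw [Fintype.card_subtype_compl, Fintype.card_coe, Fintype.card_fin]

/-- `[𝔖_n : Alt(Ω ∖ X)] ≤ 2 n^{|X|}` (for `n − |X| ≥ 2`). [folklore] -/
theorem index_altFixing_le {n : ℕ} (X : Finset (Fin n)) (h2 : 2 ≤ n - X.card) :
    ((alternatingGroup {x // x ∉ X}).map
      (Equiv.Perm.ofSubtype : Perm {x // x ∉ X} →* Perm (Fin n))).index ≤ 2 * n ^ X.card := by
  set A := (alternatingGroup {x // x ∉ X}).map
      (Equiv.Perm.ofSubtype : Perm {x // x ∉ X} →* Perm (Fin n)) with hA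
  have h1 : A.index * Nat.card A = n.factorial := by
    rw [Subgroup.index_mul_card, Nat.card_perm, Nat.card_eq_fintype_card, Fintype.card_fin]
  have h2 : 2 * Nat.card A = (n - X.card).factorial := by
    have := SmallIndex.two_mul_card_altFixing X (by rw [Fintype.card_fin]; exact h2)
    rwa [Fintype.card_fin] at this
  have h3 : (n - X.card).factorial * n.descFactorial X.card = n.factorial :=
    Nat.factorial_mul_descFactorial (by omega)
  have hpos : 0 < Nat.card A := Nat.card_pos
  have h4 : A.index * Nat.card A = 2 * n.descFactorial X.card * Nat.card A := by
    rw [h1, ← h3, ← h2]; ring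
  rw [Nat.eq_of_mul_eq_mul_right hpos h4]
  exact Nat.mul_le_mul_left _ (Nat.descFactorial_le_pow _ _)

end PermEmbeddingSub

end Summit.ValiantsHypothesis.ValiantsHypothesis.Theorems.SymPencilEquivariantSdcNotQP

end
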